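import Summits.ResolutionOfSingularities.ResolutionOfSingularities.Theorems.DirectrixCutKernels
import HarnessLib

/-! # DirectrixCutCells — decomp-res-lens-4 g41 node «DirectrixCut», FILE B (§142: the directrix CUTS of the located core C₃♮ʳᶠ♯ᵏ♯
`WildOccultDivisorialThreefoldNonLineRecurrentCompanionCurveFreeBirthRecurrentCofactorBirthRecurrentMixed…` (Theorems/CofactorCutCells) by
(PCF)/(KPCF) via `noTowerWild_split` (excluded middle exact); the two KILLS, ABSOLUTE (every `n`, hypothesis-free, port-free, no
`MinimalAt`/`h640`): the (PCF)-cell against the core letter ¬(FB) and the (¬PCF ∧ KPCF)-cell against ¬(KFB), by FILE A's declared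
dependences; the NEW LOCATED CORE C₃♮ʳᶠ♯ᵏ♯ᵉ «doubly narrow» `…NarrowCofactorNarrow…` (UNDECIDED · IDEA-NEEDED, no inhabitant claimed);
the exact hypothesis-free re-locations `…_iff_g41` of the core AND of the located residual (C₃♮ʳᶠ♯ᵏ♯ ∧ C₄) ∧ D₄ ⟺ (C₃♮ʳᶠ♯ᵏ♯ᵉ ∧ C₄) ∧ D₄
by name; down-links from g36–g39).  VERBATIM slice of HOME/decomp-res-lens-4/g41/DirectrixCut.lean. -/


noncomputable section

open CategoryTheory AlgebraicGeometry IsLocalRing TopologicalSpace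
open Literature.AlgebraicGeometry.Resolution
-- writer g14: `open …Theses` dropped — FILE B imports no route-cone module (bounce p828049: unknown namespace); no Theses name is used in this slice.
open Summit.ResolutionOfSingularities.ResolutionOfSingularities.Theorems
open WeakOrderReduction ForcedTowerClasses DivergentTowerClasses MonomialTowerClasses
open HugDimensionClasses HugDimensionKernels SurfaceShadowClasses SurfaceShadowKernels
open NearPointCut (SingularClass)
open Scheme.IdealSheafData (vanishingIdeal)

universe u

namespace Summit.ResolutionOfSingularities.ResolutionOfSingularities.Theorems.HugValuationCut

/-! ## ══ FILE B `Theorems/DirectrixCutCells.lean` (§142; imports FILE A `DirectrixCutKernels`) ══ -/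

section DirectrixCells

/-! ## §142 (g41 · NEW · CELLS) THE DIRECTRIX CUTS OF THE LOCATED CORE C₃♮ʳᶠ♯ᵏ♯, THE TWO KILLS (ABSOLUTE), THE NEW LOCATED CORE
C₃♮ʳᶠ♯ᵏ♯ᵉ «DOUBLY NARROW», EXACT RE-LOCATIONS `…_iff_g41` (HYPOTHESIS-FREE) -/

/-- **SUB-CELL C₃♮ʳᶠ♯ᵏ♯ᵖ = the g39 located core WITH A PLANE-CONE-FREE PRINCIPAL COMPANION (PCF)** — EMPTY, ABSOLUTELY (every weight,
hypothesis-free, port-free, no `MinimalAt`): LAW A against the core's own letter ¬(FB). -/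
def WildOccultDivisorialThreefoldNonLineRecurrentCompanionCurveFreeBirthRecurrentCofactorBirthRecurrentPlaneConeFreeMixedWallFreeFreshJumpShallowCompanionKangarooTowersTerminate
    (n : ℕ) : Prop :=
  NoTowerWild n fun T => (((((((((MixedResidual n T ∧ ¬ (LatentFactorTower T ∧ ThreefoldTower T)) ∧ ¬ LatentFactorTower T) ∧
    DivisorialTower T) ∧ ThreefoldTower T) ∧ ¬ FollowsLineTower T) ∧ ¬ IsolatedCompanionTower T) ∧ ¬ FollowsCurveTower T) ∧
    ¬ BirthFreeCompanionTower T) ∧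
    ¬ BirthFreeCofactorTower T) ∧
    PlaneConeFreeCompanionTower T

/-- **CELL C₃♮ʳᶠ♯ᵏ♯ⁿ «NARROW» = the g39 located core WITH EVERY PRINCIPAL COMPANION OF WEIGHT `≥ 2` CONE-RECURRENT (¬(PCF))**: the
degree-`a` initial form of every principal companion is a rational `a`-th power `c̄·Z^a` at arbitrarily late stages
(`frequently_planeConeAt_companion`).  Cut again below by the cofactor letter (KPCF). -/
def WildOccultDivisorialThreefoldNonLineRecurrentCompanionCurveFreeBirthRecurrentCofactorBirthRecurrentNarrowMixedWallFreeFreshJumpShallowCompanionKangarooTowersTerminate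
    (n : ℕ) : Prop :=
  NoTowerWild n fun T => (((((((((MixedResidual n T ∧ ¬ (LatentFactorTower T ∧ ThreefoldTower T)) ∧ ¬ LatentFactorTower T) ∧
    DivisorialTower T) ∧ ThreefoldTower T) ∧ ¬ FollowsLineTower T) ∧ ¬ IsolatedCompanionTower T) ∧ ¬ FollowsCurveTower T) ∧
    ¬ BirthFreeCompanionTower T) ∧
    ¬ BirthFreeCofactorTower T) ∧
    ¬ PlaneConeFreeCompanionTower T

/-- **SUB-CELL C₃♮ʳᶠ♯ᵏ♯ⁿᵖ = the NARROW cell WITH A PLANE-CONE-FREE COFACTOR (KPCF)** — EMPTY, ABSOLUTELY: LAW A on the cofactor chain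
against the core's letter ¬(KFB). -/
def WildOccultDivisorialThreefoldNonLineRecurrentCompanionCurveFreeBirthRecurrentCofactorBirthRecurrentNarrowCofactorPlaneConeFreeMixedWallFreeFreshJumpShallowCompanionKangarooTowersTerminate
    (n : ℕ) : Prop :=
  NoTowerWild n fun T => ((((((((((MixedResidual n T ∧ ¬ (LatentFactorTower T ∧ ThreefoldTower T)) ∧ ¬ LatentFactorTower T) ∧
    DivisorialTower T) ∧ ThreefoldTower T) ∧ ¬ FollowsLineTower T) ∧ ¬ IsolatedCompanionTower T) ∧ ¬ FollowsCurveTower T) ∧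
    ¬ BirthFreeCompanionTower T) ∧
    ¬ BirthFreeCofactorTower T) ∧
    ¬ PlaneConeFreeCompanionTower T) ∧
    PlaneConeFreeCofactorTower T

/-- **CELL C₃♮ʳᶠ♯ᵏ♯ᵉ · THE LOCATED RESIDUAL CORE after g41 — «THE DOUBLY NARROW COFACTOR-BIRTH-RECURRENT CURVE-FREE OCCULT THREEFOLD
TOWER»**: the g39 located core in which, moreover, EVERY principal companion of weight `a ≥ 2` AND ITS COFACTOR (weight `b ≥ 1`) are
RATIONAL PLANE CONES (`in_a h_j = c̄·Z^a`, `in_b K_j = c̄'·W^b`: `τ = 1`, `e = ē = 2`) AT ARBITRARILY LATE STAGES — in particular at every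
birth of either chain (LAW A), where the born branch is the unique (LAW A′) non-closed point of the regular exceptional line `ℙ(Dir)`
(LAW A″) through the next marked point.  UNDECIDED · IDEA-NEEDED (honest placement in the NODE header: in print this is the case where
CossartPiltant2008 Prop. 4.4 / CossartJannsenSaito2020 Ch. 7–9 blow up the CURVE `cl{η′}`, a centre unavailable to a forced tower; no law
on record decides point-only towers here; no certified inhabitant). -/
def WildOccultDivisorialThreefoldNonLineRecurrentCompanionCurveFreeBirthRecurrentCofactorBirthRecurrentNarrowCofactorNarrowMixedWallFreeFreshJumpShallowCompanionKangarooTowersTerminate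
    (n : ℕ) : Prop :=
  NoTowerWild n fun T => ((((((((((MixedResidual n T ∧ ¬ (LatentFactorTower T ∧ ThreefoldTower T)) ∧ ¬ LatentFactorTower T) ∧
    DivisorialTower T) ∧ ThreefoldTower T) ∧ ¬ FollowsLineTower T) ∧ ¬ IsolatedCompanionTower T) ∧ ¬ FollowsCurveTower T) ∧
    ¬ BirthFreeCompanionTower T) ∧
    ¬ BirthFreeCofactorTower T) ∧
    ¬ PlaneConeFreeCompanionTower T) ∧
    ¬ PlaneConeFreeCofactorTower T

/-- **EXACT (pure logic, `noTowerWild_split`): C₃♮ʳᶠ♯ᵏ♯ = C₃♮ʳᶠ♯ᵏ♯ᵖ ∧ C₃♮ʳᶠ♯ᵏ♯ⁿ** — the companion directrix cut. [folklore] -/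
theorem wildOccultDivisorialThreefoldNonLineRecurrentCompanionCurveFreeBirthRecurrentCofactorBirthRecurrentMixed_split_planeCone (n : ℕ) :
    WildOccultDivisorialThreefoldNonLineRecurrentCompanionCurveFreeBirthRecurrentCofactorBirthRecurrentMixedWallFreeFreshJumpShallowCompanionKangarooTowersTerminate n ↔
      WildOccultDivisorialThreefoldNonLineRecurrentCompanionCurveFreeBirthRecurrentCofactorBirthRecurrentPlaneConeFreeMixedWallFreeFreshJumpShallowCompanionKangarooTowersTerminate
          n ∧
        WildOccultDivisorialThreefoldNonLineRecurrentCompanionCurveFreeBirthRecurrentCofactorBirthRecurrentNarrowMixedWallFreeFreshJumpShallowCompanionKangarooTowersTerminate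
          n :=
  noTowerWild_split _ PlaneConeFreeCompanionTower

/-- **EXACT (pure logic): C₃♮ʳᶠ♯ᵏ♯ⁿ = C₃♮ʳᶠ♯ᵏ♯ⁿᵖ ∧ C₃♮ʳᶠ♯ᵏ♯ᵉ** — the cofactor directrix cut. [folklore] -/
theorem wildOccultDivisorialThreefoldNonLineRecurrentCompanionCurveFreeBirthRecurrentCofactorBirthRecurrentNarrowMixed_split_cofactorPlaneCone (n : ℕ) :
    WildOccultDivisorialThreefoldNonLineRecurrentCompanionCurveFreeBirthRecurrentCofactorBirthRecurrentNarrowMixedWallFreeFreshJumpShallowCompanionKangarooTowersTerminate n ↔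
      WildOccultDivisorialThreefoldNonLineRecurrentCompanionCurveFreeBirthRecurrentCofactorBirthRecurrentNarrowCofactorPlaneConeFreeMixedWallFreeFreshJumpShallowCompanionKangarooTowersTerminate
          n ∧
        WildOccultDivisorialThreefoldNonLineRecurrentCompanionCurveFreeBirthRecurrentCofactorBirthRecurrentNarrowCofactorNarrowMixedWallFreeFreshJumpShallowCompanionKangarooTowersTerminate
          n :=
  noTowerWild_split _ PlaneConeFreeCofactorTower

/-- **THE FIRST KILL — SUB-CELL C₃♮ʳᶠ♯ᵏ♯ᵖ IS EMPTY, ABSOLUTELY (every `p`, field, weight; hypothesis-free, port-free, no `MinimalAt`)**: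
(PCF) ⟹ (FB) (`birthFreeCompanionTower_of_planeConeFreeCompanionTower`, LAW A load-bearing) against the cell's ¬(FB). [folklore] -/
theorem wildOccultDivisorialThreefoldNonLineRecurrentCompanionCurveFreeBirthRecurrentCofactorBirthRecurrentPlaneConeFreeMixed_holds (n : ℕ) :
    WildOccultDivisorialThreefoldNonLineRecurrentCompanionCurveFreeBirthRecurrentCofactorBirthRecurrentPlaneConeFreeMixedWallFreeFreshJumpShallowCompanionKangarooTowersTerminate
      n := by
  intro p _ _ k _ _ T g hB hD _ hP
  exact hP.1.1.2 (birthFreeCompanionTower_of_planeConeFreeCompanionTower T g hB hD hP.1.1.1.1.1.1.2 hP.2)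

/-- **THE SECOND KILL — SUB-CELL C₃♮ʳᶠ♯ᵏ♯ⁿᵖ IS EMPTY, ABSOLUTELY**: (KPCF) ⟹ (KFB)
(`birthFreeCofactorTower_of_planeConeFreeCofactorTower`, LAW A on the cofactor chain) against the cell's ¬(KFB). [folklore] -/
theorem wildOccultDivisorialThreefoldNonLineRecurrentCompanionCurveFreeBirthRecurrentCofactorBirthRecurrentNarrowCofactorPlaneConeFreeMixed_holds (n : ℕ) :
    WildOccultDivisorialThreefoldNonLineRecurrentCompanionCurveFreeBirthRecurrentCofactorBirthRecurrentNarrowCofactorPlaneConeFreeMixedWallFreeFreshJumpShallowCompanionKangarooTowersTerminate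
      n := by
  intro p _ _ k _ _ T g hB hD _ hP
  exact hP.1.1.2 (birthFreeCofactorTower_of_planeConeFreeCofactorTower T g hB hD hP.1.1.1.1.1.1.1.2 hP.2)

/-- **EXACT RE-LOCATION OF THE g39 LOCATED CORE, HYPOTHESIS-FREE, weight by weight: C₃♮ʳᶠ♯ᵏ♯ ⟺ C₃♮ʳᶠ♯ᵏ♯ᵉ.** [folklore] -/
theorem wildOccultDivisorialThreefoldNonLineRecurrentCompanionCurveFreeBirthRecurrentCofactorBirthRecurrentMixed_iff_g41 (n : ℕ) :
    WildOccultDivisorialThreefoldNonLineRecurrentCompanionCurveFreeBirthRecurrentCofactorBirthRecurrentMixedWallFreeFreshJumpShallowCompanionKangarooTowersTerminate n ↔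
      WildOccultDivisorialThreefoldNonLineRecurrentCompanionCurveFreeBirthRecurrentCofactorBirthRecurrentNarrowCofactorNarrowMixedWallFreeFreshJumpShallowCompanionKangarooTowersTerminate
        n :=
  ⟨fun h => ((wildOccultDivisorialThreefoldNonLineRecurrentCompanionCurveFreeBirthRecurrentCofactorBirthRecurrentNarrowMixed_split_cofactorPlaneCone n).mp ((wildOccultDivisorialThreefoldNonLineRecurrentCompanionCurveFreeBirthRecurrentCofactorBirthRecurrentMixed_split_planeCone n).mp h).2).2,
    fun h => (wildOccultDivisorialThreefoldNonLineRecurrentCompanionCurveFreeBirthRecurrentCofactorBirthRecurrentMixed_split_planeCone n).mpr ⟨wildOccultDivisorialThreefoldNonLineRecurrentCompanionCurveFreeBirthRecurrentCofactorBirthRecurrentPlaneConeFreeMixed_holds n,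
      (wildOccultDivisorialThreefoldNonLineRecurrentCompanionCurveFreeBirthRecurrentCofactorBirthRecurrentNarrowMixed_split_cofactorPlaneCone n).mpr ⟨wildOccultDivisorialThreefoldNonLineRecurrentCompanionCurveFreeBirthRecurrentCofactorBirthRecurrentNarrowCofactorPlaneConeFreeMixed_holds n, h⟩⟩⟩

/-- BY NAME: sub-cell C₃♮ʳᶠ♯ᵏ♯ᵖ over all weights (DECIDED, ABSOLUTELY). -/
def NoWildOccultDivisorialThreefoldNonLineRecurrentCompanionCurveFreeBirthRecurrentCofactorBirthRecurrentPlaneConeFreeMixedTowers : Prop :=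
  ∀ n : ℕ, 1 ≤ n →
    WildOccultDivisorialThreefoldNonLineRecurrentCompanionCurveFreeBirthRecurrentCofactorBirthRecurrentPlaneConeFreeMixedWallFreeFreshJumpShallowCompanionKangarooTowersTerminate
      n

/-- BY NAME: the NARROW cell C₃♮ʳᶠ♯ᵏ♯ⁿ over all weights. -/
def NoWildOccultDivisorialThreefoldNonLineRecurrentCompanionCurveFreeBirthRecurrentCofactorBirthRecurrentNarrowMixedTowers : Prop :=
  ∀ n : ℕ, 1 ≤ n →
    WildOccultDivisorialThreefoldNonLineRecurrentCompanionCurveFreeBirthRecurrentCofactorBirthRecurrentNarrowMixedWallFreeFreshJumpShallowCompanionKangarooTowersTerminate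
      n

/-- BY NAME: sub-cell C₃♮ʳᶠ♯ᵏ♯ⁿᵖ over all weights (DECIDED, ABSOLUTELY). -/
def NoWildOccultDivisorialThreefoldNonLineRecurrentCompanionCurveFreeBirthRecurrentCofactorBirthRecurrentNarrowCofactorPlaneConeFreeMixedTowers : Prop :=
  ∀ n : ℕ, 1 ≤ n →
    WildOccultDivisorialThreefoldNonLineRecurrentCompanionCurveFreeBirthRecurrentCofactorBirthRecurrentNarrowCofactorPlaneConeFreeMixedWallFreeFreshJumpShallowCompanionKangarooTowersTerminate
      n

/-- BY NAME: **no wild DOUBLY NARROW cofactor-birth-recurrent curve-free occult divisorial threefold tower** (CELL C₃♮ʳᶠ♯ᵏ♯ᵉ; UNDECIDED —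
the located residual core after g41). -/
def NoWildOccultDivisorialThreefoldNonLineRecurrentCompanionCurveFreeBirthRecurrentCofactorBirthRecurrentNarrowCofactorNarrowMixedTowers : Prop :=
  ∀ n : ℕ, 1 ≤ n →
    WildOccultDivisorialThreefoldNonLineRecurrentCompanionCurveFreeBirthRecurrentCofactorBirthRecurrentNarrowCofactorNarrowMixedWallFreeFreshJumpShallowCompanionKangarooTowersTerminate
      n

/-- BY NAME: **THE LOCATED RESIDUAL of the lens-4 NP column after g41 — «no wild occult mixed tower that (is a doubly narrow
cofactor-birth-recurrent curve-free ruled-recurrent divisorial threefold following no line) or is not a threefold»** = (C₃♮ʳᶠ♯ᵏ♯ᵉ ∧ C₄) ∧ D₄. -/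
def NoWildOccultDoublyNarrowCofactorBirthRecurrentCurveFreeCompanionNonLineMixedTowers : Prop :=
  (NoWildOccultDivisorialThreefoldNonLineRecurrentCompanionCurveFreeBirthRecurrentCofactorBirthRecurrentNarrowCofactorNarrowMixedTowers ∧
      NoWildOccultDivisorialNonThreefoldMixedTowers) ∧
    NoWildOccultNonDivisorialNonThreefoldMixedTowers

/-- **SUB-CELL C₃♮ʳᶠ♯ᵏ♯ᵖ DECIDED BY NAME — ABSOLUTELY.** [folklore] -/
theorem noWildOccultDivisorialThreefoldNonLineRecurrentCompanionCurveFreeBirthRecurrentCofactorBirthRecurrentPlaneConeFreeMixedTowers_holds :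
    NoWildOccultDivisorialThreefoldNonLineRecurrentCompanionCurveFreeBirthRecurrentCofactorBirthRecurrentPlaneConeFreeMixedTowers := fun n _ =>
  wildOccultDivisorialThreefoldNonLineRecurrentCompanionCurveFreeBirthRecurrentCofactorBirthRecurrentPlaneConeFreeMixed_holds n

/-- **SUB-CELL C₃♮ʳᶠ♯ᵏ♯ⁿᵖ DECIDED BY NAME — ABSOLUTELY.** [folklore] -/
theorem noWildOccultDivisorialThreefoldNonLineRecurrentCompanionCurveFreeBirthRecurrentCofactorBirthRecurrentNarrowCofactorPlaneConeFreeMixedTowers_holds :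
    NoWildOccultDivisorialThreefoldNonLineRecurrentCompanionCurveFreeBirthRecurrentCofactorBirthRecurrentNarrowCofactorPlaneConeFreeMixedTowers := fun n _ =>
  wildOccultDivisorialThreefoldNonLineRecurrentCompanionCurveFreeBirthRecurrentCofactorBirthRecurrentNarrowCofactorPlaneConeFreeMixed_holds n

/-- **EXACT RE-LOCATION BY NAME, HYPOTHESIS-FREE: CELL C₃♮ʳᶠ♯ᵏ♯ ⟺ CELL C₃♮ʳᶠ♯ᵏ♯ᵉ.** [folklore] -/
theorem noWildOccultDivisorialThreefoldNonLineRecurrentCompanionCurveFreeBirthRecurrentCofactorBirthRecurrentMixedTowers_iff_g41 :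
    NoWildOccultDivisorialThreefoldNonLineRecurrentCompanionCurveFreeBirthRecurrentCofactorBirthRecurrentMixedTowers ↔
      NoWildOccultDivisorialThreefoldNonLineRecurrentCompanionCurveFreeBirthRecurrentCofactorBirthRecurrentNarrowCofactorNarrowMixedTowers :=
  ⟨fun h n hn => (wildOccultDivisorialThreefoldNonLineRecurrentCompanionCurveFreeBirthRecurrentCofactorBirthRecurrentMixed_iff_g41 n).mp (h n hn), fun h n hn => (wildOccultDivisorialThreefoldNonLineRecurrentCompanionCurveFreeBirthRecurrentCofactorBirthRecurrentMixed_iff_g41 n).mpr (h n hn)⟩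

/-- **EXACT RE-LOCATION BY NAME, HYPOTHESIS-FREE: CELL C₃♮ʳᶠ♯ᵏ♯ ⟺ CELL C₃♮ʳᶠ♯ᵏ♯ⁿ (the NARROW cell alone).** [folklore] -/
theorem noWildOccultDivisorialThreefoldNonLineRecurrentCompanionCurveFreeBirthRecurrentCofactorBirthRecurrentMixedTowers_iff_narrow :
    NoWildOccultDivisorialThreefoldNonLineRecurrentCompanionCurveFreeBirthRecurrentCofactorBirthRecurrentMixedTowers ↔
      NoWildOccultDivisorialThreefoldNonLineRecurrentCompanionCurveFreeBirthRecurrentCofactorBirthRecurrentNarrowMixedTowers :=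
  ⟨fun h n hn => ((wildOccultDivisorialThreefoldNonLineRecurrentCompanionCurveFreeBirthRecurrentCofactorBirthRecurrentMixed_split_planeCone n).mp (h n hn)).2,
    fun h n hn => (wildOccultDivisorialThreefoldNonLineRecurrentCompanionCurveFreeBirthRecurrentCofactorBirthRecurrentMixed_split_planeCone n).mpr ⟨wildOccultDivisorialThreefoldNonLineRecurrentCompanionCurveFreeBirthRecurrentCofactorBirthRecurrentPlaneConeFreeMixed_holds n, h n hn⟩⟩

/-- **EXACT RE-LOCATION BY NAME, HYPOTHESIS-FREE: the g39 located residual ⟺ the g41 located residual.** [folklore] -/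
theorem noWildOccultCofactorBirthRecurrentCurveFreeCompanionNonLineMixedTowers_iff_g41 :
    NoWildOccultCofactorBirthRecurrentCurveFreeCompanionNonLineMixedTowers ↔ NoWildOccultDoublyNarrowCofactorBirthRecurrentCurveFreeCompanionNonLineMixedTowers := by
  unfold NoWildOccultCofactorBirthRecurrentCurveFreeCompanionNonLineMixedTowers NoWildOccultDoublyNarrowCofactorBirthRecurrentCurveFreeCompanionNonLineMixedTowers
  rw [noWildOccultDivisorialThreefoldNonLineRecurrentCompanionCurveFreeBirthRecurrentCofactorBirthRecurrentMixedTowers_iff_g41]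

/-- down-link (HYPOTHESIS-FREE): the g41 located residual ⟸ the g39 located residual. [folklore] -/
theorem noWildOccultDoublyNarrowCofactorBirthRecurrentCurveFreeCompanionNonLineMixedTowers_of_g39
    (h : NoWildOccultCofactorBirthRecurrentCurveFreeCompanionNonLineMixedTowers) : NoWildOccultDoublyNarrowCofactorBirthRecurrentCurveFreeCompanionNonLineMixedTowers :=
  noWildOccultCofactorBirthRecurrentCurveFreeCompanionNonLineMixedTowers_iff_g41.mp h

/-- up-link (HYPOTHESIS-FREE): the g41 located residual ⟹ the g39 located residual (the cut loses nothing). [folklore] -/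
theorem noWildOccultCofactorBirthRecurrentCurveFreeCompanionNonLineMixedTowers_of_g41
    (h : NoWildOccultDoublyNarrowCofactorBirthRecurrentCurveFreeCompanionNonLineMixedTowers) : NoWildOccultCofactorBirthRecurrentCurveFreeCompanionNonLineMixedTowers :=
  noWildOccultCofactorBirthRecurrentCurveFreeCompanionNonLineMixedTowers_iff_g41.mpr h

/-- down-link (HYPOTHESIS-FREE): the g41 located residual ⟸ the g38 located residual. [folklore] -/
theorem noWildOccultDoublyNarrowCofactorBirthRecurrentCurveFreeCompanionNonLineMixedTowers_of_g38
    (h : NoWildOccultBirthRecurrentCurveFreeCompanionNonLineMixedTowers) : NoWildOccultDoublyNarrowCofactorBirthRecurrentCurveFreeCompanionNonLineMixedTowers :=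
  noWildOccultDoublyNarrowCofactorBirthRecurrentCurveFreeCompanionNonLineMixedTowers_of_g39 (noWildOccultCofactorBirthRecurrentCurveFreeCompanionNonLineMixedTowers_of_g38 h)

/-- down-link (HYPOTHESIS-FREE): the g41 located residual ⟸ the g37 located residual. [folklore] -/
theorem noWildOccultDoublyNarrowCofactorBirthRecurrentCurveFreeCompanionNonLineMixedTowers_of_g37
    (h : NoWildOccultCurveFreeRecurrentCompanionNonLineMixedTowers) : NoWildOccultDoublyNarrowCofactorBirthRecurrentCurveFreeCompanionNonLineMixedTowers :=
  noWildOccultDoublyNarrowCofactorBirthRecurrentCurveFreeCompanionNonLineMixedTowers_of_g39 (noWildOccultCofactorBirthRecurrentCurveFreeCompanionNonLineMixedTowers_of_g37 h)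

/-- down-link (HYPOTHESIS-FREE): the g41 located residual ⟸ the g36 located residual. [folklore] -/
theorem noWildOccultDoublyNarrowCofactorBirthRecurrentCurveFreeCompanionNonLineMixedTowers_of_g36
    (h : NoWildOccultRecurrentCompanionNonLineMixedTowers) : NoWildOccultDoublyNarrowCofactorBirthRecurrentCurveFreeCompanionNonLineMixedTowers :=
  noWildOccultDoublyNarrowCofactorBirthRecurrentCurveFreeCompanionNonLineMixedTowers_of_g39 (noWildOccultCofactorBirthRecurrentCurveFreeCompanionNonLineMixedTowers_of_g36 h)

end DirectrixCells

end Summit.ResolutionOfSingularities.ResolutionOfSingularities.Theorems.HugValuationCut
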